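import Mathlib.GroupTheory.Perm.Fin
import Literature.Combinatorics.SimpleGraph.MatchingMinorBicontraction
import Literature.Combinatorics.SimpleGraph.PfaffianIsomorphism
import HarnessLib

/-!
# Pfaffian bipartite graphs are closed under matching minors (easy direction of Little's theorem)

Topic `Combinatorics/SimpleGraph`; theorems, plus three auxiliary `def`s (the induced signing
`bicontractSigning`, the `pivot` column and the lift `liftPerm` of a perfect matching along a
bicontraction); no new notion, no named fact. Sequel to `PfaffianIsomorphism.lean` and
`MatchingMinorBicontraction.lean` (definition item `defn-IsMatchingMinor` of route
`ValiantsHypothesis/PolyaContinued`, wanted fact (ii): `K_{3,3}` as the excluded matching minor of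
Pfaffian bipartite graphs). The named fact `Little1975_isPfaffianBipartite_iff_not_isMatchingMinor`
(`LittleTheorem.lean`) is the equivalence "Pólya matrix ⟺ no `K_{3,3}` matching minor"
(Robertson–Seymour–Thomas 1999 (1.2) with (1.1), (4.2)); this file PROVES its easy half —
McCuaig 2004, Theorem 12, direction "⇒" (p. 28: `K_{3,3}` has no unbalanced weighting, and
unbalanced weightings restrict to well-fitted subgraphs, Lemma 22) — for matching minors in the
edge-set encoding of `MatchingMinor.lean`:

* `IsCentralSubgraph.isPfaffianBipartite` — a central (conformal) subgraph `K` of a Pfaffian `G`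
  is Pfaffian: restrict the signing along the row/column embeddings; a perfect matching `σ` of `K`
  extends by the perfect matching `τ` of `G ∖ V(K)` to a perfect matching of `G` whose sign is
  `sign σ` times a constant (`Equiv.Perm.sign_trans_trans`), so all perfect matchings of `K` get
  one common sign;
* `IsPolyaSigning.bicontractRowZero` / `isPfaffianBipartite_bicontractRowZero` — bicontracting the
  row vertex `0` of degree two (neighbours: columns `0, 1`) preserves Pfaffian-ness: a perfect
  matching `σ'` of the bicontraction lifts (`liftPerm`, via `Equiv.Perm.decomposeFin`) to the
  perfect matching of `G` that resolves the merged edge at row `i₀ + 1` (`σ' i₀ = 0`) to column `0`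
  if `(i₀+1, 0) ∈ G` and to column `1` otherwise, and matches row `0` to the other column; the
  induced signing `bicontractSigning` of the merged column absorbs the sign of row `0`'s edge and
  the sign change `sign (lift) = ∓ sign σ'`;
* assembled with `IsIsomorphic.isPfaffianBipartite` (`PfaffianIsomorphism.lean`):
  `BicontractionStep.isPfaffianBipartite`, `Bicontracts.isPfaffianBipartite`,
  `IsMatchingMinor.isPfaffianBipartite` (**matching minors of Pfaffian bipartite graphs are
  Pfaffian**), and `IsMatchingMinor.not_isPfaffianBipartite`: **a bipartite graph with a `K_{3,3}`
  matching minor has no Pólya matrix** (with `not_isPfaffianBipartite_univ_fin_three`), i.e. the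
  "⇒" half of `Little1975_isPfaffianBipartite_iff_not_isMatchingMinor`, unconditionally.

## References

* C. H. C. Little, *A characterization of convertible (0,1)-matrices*, J. Combin. Theory Ser. B
  18 (1975) 187–208. [Little1975]
* W. McCuaig, *Pólya's permanent problem*, Electron. J. Combin. 11 (2004) R79, Theorem 12 (proof
  of "⇒", p. 28) and Lemma 22. [McCuaig2004]
* N. Robertson, P. D. Seymour, R. Thomas, *Permanents, Pfaffian orientations, and even directed
  circuits*, Ann. of Math. 150 (1999) 929–975, (1.2), §4. [RobertsonSeymourThomas1999]
-/

namespace Literature.Combinatorics.SimpleGraph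

open Equiv Finset

/-! ### Central subgraphs -/

section Central

variable {l n : ℕ}

/-- **A central (conformal) subgraph of a Pfaffian bipartite graph is Pfaffian**: restrict the
signing along the row/column embeddings; a perfect matching `σ` of `K` extends by the perfect
matching `τ` of `G ∖ V(K)` to a perfect matching of `G` whose sign is `sign σ` times a constant
(cf. McCuaig 2004, proof of Theorem 12 "⇒" with Lemma 22: an unbalanced weighting of `G`
restricts to one of any well-fitted subgraph). [folklore] -/
theorem IsCentralSubgraph.isPfaffianBipartite {K : Finset (Fin l × Fin l)}
    {G : Finset (Fin n × Fin n)} (h : IsCentralSubgraph K G) (hG : IsPfaffianBipartite G) :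
    IsPfaffianBipartite K := by
  classical
  obtain ⟨r, c, hKG, τ, hτ⟩ := h
  obtain ⟨s, hs⟩ := hG
  -- the lift of a permutation of the rows of `K` to the rows of `G`
  set P : Fin n ≃ Fin l ⊕ {i : Fin n // i ∉ Set.range r} := (rowSplitEquiv r).symm with hP
  set Q : Fin l ⊕ {i : Fin n // i ∉ Set.range r} ≃ Fin n := colSplitEquiv r c τ with hQ
  have lift_r : ∀ (σ : Perm (Fin l)) (a : Fin l),
      (P.trans ((Perm.sumCongr σ 1).trans Q)) (r a) = c (σ a) := fun σ a => by
    have h1 : P (r a) = Sum.inl a := by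
      rw [hP, Equiv.symm_apply_eq]; exact (rowSplitEquiv_inl r a).symm
    simp [h1, hQ]
  have lift_x : ∀ (σ : Perm (Fin l)) (x : {i : Fin n // i ∉ Set.range r}),
      (P.trans ((Perm.sumCongr σ 1).trans Q)) (x : Fin n) =
        ((τ x : {j : Fin n // j ∉ Set.range c}) : Fin n) := fun σ x => by
    have h1 : P x = Sum.inr x := by
      rw [hP, Equiv.symm_apply_eq]; exact (rowSplitEquiv_inr r x).symm
    simp [h1, hQ]
  -- all lifted perfect matchings of `K` are perfect matchings of `G`, hence positive; the sign
  -- and the sign product of the lift differ from those of `σ` by constants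
  refine isPfaffianBipartite_of_forall_sign_eq (fun e => s (r e.1, c e.2))
    ((Perm.sign (P.trans Q) * ∏ x : {i : Fin n // i ∉ Set.range r}, s (x, τ x))⁻¹)
    fun σ hσ => ?_
  have hmem : ∀ i, (i, (P.trans ((Perm.sumCongr σ 1).trans Q)) i) ∈ G := fun i => by
    obtain ⟨y, rfl⟩ := (rowSplitEquiv r).surjective i
    rcases y with a | x
    · rw [rowSplitEquiv_inl, lift_r]; exact hKG _ (hσ a)
    · rw [rowSplitEquiv_inr, lift_x]; exact hτ x
  have hpol := hs _ hmem
  have hsign : Perm.sign (P.trans ((Perm.sumCongr σ 1).trans Q)) =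
      Perm.sign σ * Perm.sign (P.trans Q) := by
    rw [Perm.sign_trans_trans, Perm.sign_sumCongr, Perm.sign_one, mul_one]
  have hprod : ∏ i, s (i, (P.trans ((Perm.sumCongr σ 1).trans Q)) i) =
      (∏ a, s (r a, c (σ a))) * ∏ x : {i : Fin n // i ∉ Set.range r}, s (x, τ x) := by
    have e1 : ∏ y, s (rowSplitEquiv r y, (P.trans ((Perm.sumCongr σ 1).trans Q))
        (rowSplitEquiv r y)) = ∏ i, s (i, (P.trans ((Perm.sumCongr σ 1).trans Q)) i) :=
      Fintype.prod_equiv (rowSplitEquiv r) _ _ fun _ => rfl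
    rw [← e1, Fintype.prod_sum_type]
    simp only [rowSplitEquiv_inl, rowSplitEquiv_inr, lift_r, lift_x]
  rw [hsign, hprod] at hpol
  rw [eq_inv_iff_mul_eq_one, ← hpol]
  simp only [mul_assoc, mul_comm, mul_left_comm]

end Central

/-! ### Bicontraction -/

section Bicontraction

variable {m : ℕ}

/-- The signing of the bicontraction induced by a signing `s` of `G` (row `0` of degree two with
neighbours the columns `0, 1`): unmerged edges keep their sign; the merged edge at row `i` (coming
from `(i+1, 0)` if that is an edge of `G`, else from `(i+1, 1)`) is signed by `∓ s (0, p) s (i+1,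
1-p)` — the sign of the OTHER edge at row `0` times the sign of the merged edge's origin, negated
in the first case (the lifted perfect matching of `G` then differs from the shifted one by a
transposition). [folklore] -/
def bicontractSigning (G : Finset (Fin (m + 2) × Fin (m + 2)))
    (s : Fin (m + 2) × Fin (m + 2) → ℤˣ) : Fin (m + 1) × Fin (m + 1) → ℤˣ :=
  fun e => if e.2 = 0 then
      (if (e.1.succ, (0 : Fin (m + 2))) ∈ G then -(s (0, 1) * s (e.1.succ, 0))
        else s (0, 0) * s (e.1.succ, 1))
    else s (e.1.succ, e.2.succ)

/-- The induced signing on the merged column. [folklore] -/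
theorem bicontractSigning_zero (G : Finset (Fin (m + 2) × Fin (m + 2)))
    (s : Fin (m + 2) × Fin (m + 2) → ℤˣ) (i : Fin (m + 1)) :
    bicontractSigning G s (i, 0) =
      if (i.succ, (0 : Fin (m + 2))) ∈ G then -(s (0, 1) * s (i.succ, 0))
        else s (0, 0) * s (i.succ, 1) := by
  simp [bicontractSigning]

/-- The induced signing off the merged column is the shifted signing. [folklore] -/
theorem bicontractSigning_of_ne (G : Finset (Fin (m + 2) × Fin (m + 2)))
    (s : Fin (m + 2) × Fin (m + 2) → ℤˣ) (i : Fin (m + 1)) {j : Fin (m + 1)} (hj : j ≠ 0) :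
    bicontractSigning G s (i, j) = s (i.succ, j.succ) := by
  simp [bicontractSigning, hj]

/-- The pivot column of a perfect matching `σ'` of the bicontraction: where row `0` of `G` is
matched by the lift — column `1` if the merged edge of `σ'` (at the row `i₀ + 1`, `σ' i₀ = 0`)
comes from column `0` of `G`, else column `0`. [folklore] -/
def pivot (G : Finset (Fin (m + 2) × Fin (m + 2))) (σ' : Perm (Fin (m + 1))) : Fin (m + 2) :=
  if ((σ'.symm 0).succ, (0 : Fin (m + 2))) ∈ G then 1 else 0

/-- **The lift of a perfect matching of the bicontraction to `G`**: row `0 ↦ pivot G σ'`, row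
`i + 1 ↦ (σ' i) + 1` for `σ' i ≠ 0`, and the row carrying the merged edge `↦` the column `0` or
`1` other than the pivot (`Equiv.Perm.decomposeFin`). [folklore] -/
def liftPerm (G : Finset (Fin (m + 2) × Fin (m + 2))) (σ' : Perm (Fin (m + 1))) :
    Perm (Fin (m + 2)) :=
  Perm.decomposeFin.symm (pivot G σ', σ')

/-- Row `0` of the lift goes to the pivot column. [folklore] -/
theorem liftPerm_zero (G : Finset (Fin (m + 2) × Fin (m + 2))) (σ' : Perm (Fin (m + 1))) :
    liftPerm G σ' 0 = pivot G σ' := by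
  simp [liftPerm]

/-- Rows `i + 1` not carrying the merged edge go where `σ'` sends them, shifted. [folklore] -/
theorem liftPerm_succ_of_ne (G : Finset (Fin (m + 2) × Fin (m + 2))) (σ' : Perm (Fin (m + 1)))
    {i : Fin (m + 1)} (hi : σ' i ≠ 0) : liftPerm G σ' i.succ = (σ' i).succ := by
  rw [liftPerm, Perm.decomposeFin_symm_apply_succ, swap_apply_of_ne_of_ne (Fin.succ_ne_zero _)]
  unfold pivot
  split_ifs
  · rw [Ne, ← Fin.succ_zero_eq_one, Fin.succ_inj]; exact hi
  · exact Fin.succ_ne_zero _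

/-- The row carrying the merged edge goes to the column `0` or `1` other than the pivot.
[folklore] -/
theorem liftPerm_succ_symm_zero (G : Finset (Fin (m + 2) × Fin (m + 2)))
    (σ' : Perm (Fin (m + 1))) :
    liftPerm G σ' (σ'.symm 0).succ =
      if ((σ'.symm 0).succ, (0 : Fin (m + 2))) ∈ G then 0 else 1 := by
  rw [liftPerm, Perm.decomposeFin_symm_apply_succ, Equiv.apply_symm_apply, Fin.succ_zero_eq_one]
  unfold pivot
  split_ifs <;> simp

/-- The sign of the lift: `- sign σ'` if the pivot is column `1`, `sign σ'` if it is column `0`.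
[folklore] -/
theorem sign_liftPerm (G : Finset (Fin (m + 2) × Fin (m + 2))) (σ' : Perm (Fin (m + 1))) :
    Perm.sign (liftPerm G σ') =
      (if ((σ'.symm 0).succ, (0 : Fin (m + 2))) ∈ G then -1 else 1) * Perm.sign σ' := by
  rw [liftPerm, Perm.decomposeFin.symm_sign]
  unfold pivot
  split_ifs with h <;> simp_all

/-- **Bicontraction preserves Pólya signings** (normal position): if row `0` of `G` has degree
two with neighbours the columns `0, 1` and `s` is a Pólya signing of `G`, then
`bicontractSigning G s` is a Pólya signing of `bicontractRowZero G` (cf. Little 1975, §4: "reduction" of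
convertible matrices; McCuaig 2004, proof of Theorem 12 "⇒": bisubdivision). [folklore] -/
theorem IsPolyaSigning.bicontractRowZero {G : Finset (Fin (m + 2) × Fin (m + 2))}
    (hG : RowZeroBicontractible G) {s : Fin (m + 2) × Fin (m + 2) → ℤˣ}
    (hs : IsPolyaSigning G s) :
    IsPolyaSigning (bicontractRowZero G) (bicontractSigning G s) := by
  intro σ' hσ'
  have hσi₀ : σ' (σ'.symm 0) = 0 := σ'.apply_symm_apply 0
  -- the lift is a perfect matching of `G`
  have hmem : ∀ i, (i, liftPerm G σ' i) ∈ G := by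
    intro i
    induction i using Fin.cases with
    | zero =>
      rw [liftPerm_zero]
      unfold pivot
      split_ifs
      · exact (hG.zero_mem_iff 1).2 (Or.inr rfl)
      · exact (hG.zero_mem_iff 0).2 (Or.inl rfl)
    | succ i =>
      by_cases hi : σ' i = 0
      · obtain rfl : i = σ'.symm 0 := by rw [Equiv.eq_symm_apply]; exact hi
        rw [liftPerm_succ_symm_zero]
        have h0 := hσ' (σ'.symm 0)
        rw [hσi₀, mem_bicontractRowZero_iff] at h0
        split_ifs with h
        · exact h
        · rcases h0 with h0 | ⟨-, h0⟩
          · simpa using h0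
          · exact absurd h0 h
      · rw [liftPerm_succ_of_ne G σ' hi]
        rcases (mem_bicontractRowZero_iff G i (σ' i)).1 (hσ' i) with h1 | ⟨h1, -⟩
        · exact h1
        · exact absurd h1 hi
  have hpol := hs (liftPerm G σ') hmem
  -- split both sign products at row `0` (lift only) and at the row `σ'⁻¹ 0` of the merged edge
  rw [Fin.prod_univ_succ, liftPerm_zero, ← Finset.mul_prod_erase _ _ (Finset.mem_univ (σ'.symm 0)),
    liftPerm_succ_symm_zero, sign_liftPerm] at hpol
  rw [← Finset.mul_prod_erase _ _ (Finset.mem_univ (σ'.symm 0)), hσi₀, bicontractSigning_zero]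
  have hrest : ∏ i ∈ Finset.univ.erase (σ'.symm 0), bicontractSigning G s (i, σ' i) =
      ∏ i ∈ Finset.univ.erase (σ'.symm 0), s (i.succ, liftPerm G σ' i.succ) := by
    refine Finset.prod_congr rfl fun i hi => ?_
    have hne : σ' i ≠ 0 := fun h0 =>
      (Finset.mem_erase.1 hi).1 (σ'.injective (h0.trans hσi₀.symm))
    rw [liftPerm_succ_of_ne G σ' hne, bicontractSigning_of_ne G s i hne]
  rw [hrest]
  unfold pivot at hpol
  -- compare in `ℤ`
  rw [← Units.val_eq_one] at hpol ⊢
  split_ifs at hpol ⊢ with h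
  · push_cast at hpol ⊢
    linear_combination hpol
  · push_cast at hpol ⊢
    linear_combination hpol

/-- **The bicontraction of a Pfaffian graph (normal position) is Pfaffian.** [folklore] -/
theorem isPfaffianBipartite_bicontractRowZero {G : Finset (Fin (m + 2) × Fin (m + 2))}
    (hG : RowZeroBicontractible G) (h : IsPfaffianBipartite G) :
    IsPfaffianBipartite (bicontractRowZero G) :=
  let ⟨s, hs⟩ := h; ⟨bicontractSigning G s, hs.bicontractRowZero hG⟩

/-- **One bicontraction (up to isomorphism on both sides) preserves Pfaffian-ness.**
[folklore] -/
theorem BicontractionStep.isPfaffianBipartite {G : Finset (Fin (m + 2) × Fin (m + 2))}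
    {G' : Finset (Fin (m + 1) × Fin (m + 1))} (h : BicontractionStep G G')
    (hG : IsPfaffianBipartite G) : IsPfaffianBipartite G' := by
  obtain ⟨G₀, hGG₀, hG₀, hG₀G'⟩ := h
  exact hG₀G'.isPfaffianBipartite
    (isPfaffianBipartite_bicontractRowZero hG₀ (hGG₀.isPfaffianBipartite hG))

end Bicontraction

/-! ### Matching minors -/

/-- **A sequence of bicontractions preserves Pfaffian-ness.** [folklore] -/
theorem Bicontracts.isPfaffianBipartite {n m : ℕ} {G : Finset (Fin n × Fin n)}
    {H : Finset (Fin m × Fin m)} (h : Bicontracts G H) (hG : IsPfaffianBipartite G) :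
    IsPfaffianBipartite H := by
  induction h with
  | of_isIsomorphic hiso => exact hiso.isPfaffianBipartite hG
  | step hstep _ ih => exact ih (hstep.isPfaffianBipartite hG)

/-- **Matching minors of Pfaffian bipartite graphs are Pfaffian** (Little 1975; McCuaig 2004,
Theorem 12 "⇒": an unbalanced `{−1, 1}`-edge weighting restricts to well-fitted subgraphs and
survives bicontraction), in the edge-set encoding: `IsMatchingMinor H G → IsPfaffianBipartite G →
IsPfaffianBipartite H`. [cite: McCuaig2004, Theorem 12 (⇒)] -/
theorem IsMatchingMinor.isPfaffianBipartite {m n : ℕ} {H : Finset (Fin m × Fin m)}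
    {G : Finset (Fin n × Fin n)} (h : IsMatchingMinor H G) (hG : IsPfaffianBipartite G) :
    IsPfaffianBipartite H := by
  obtain ⟨k, K, hK, hKH⟩ := h
  exact hKH.isPfaffianBipartite (hK.isPfaffianBipartite hG)

/-- **The easy direction of Little's theorem: a bipartite graph with a `K_{3,3}` matching minor
has no Pólya matrix** (Little 1975, Corollary 1, "⇐": "A bipartite graph `G` is non-Pfaffian if
[and only if] `G` contains an even subdivision `J` of `K_{3,3}` such that `G − V(J)` has a
1-factor", with Robertson–Seymour–Thomas (4.2): contained = weakly contained for cubic `H`;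
McCuaig 2004, Theorem 12 "⇒": `K_{3,3}` has no unbalanced weighting — here
`not_isPfaffianBipartite_univ_fin_three` — plus the preceding descent). This is the "⇒" half of
the named fact `Little1975_isPfaffianBipartite_iff_not_isMatchingMinor` of `LittleTheorem.lean`,
proved. [cite: McCuaig2004, Theorem 12 (⇒)] -/
theorem IsMatchingMinor.not_isPfaffianBipartite {n : ℕ} {G : Finset (Fin n × Fin n)}
    (h : IsMatchingMinor (Finset.univ : Finset (Fin 3 × Fin 3)) G) : ¬ IsPfaffianBipartite G :=
  fun hG => not_isPfaffianBipartite_univ_fin_three (h.isPfaffianBipartite hG)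

/-- Contrapositive: a Pfaffian bipartite graph has no `K_{3,3}` matching minor. [cite: McCuaig2004, Theorem 12 (⇒)] -/
theorem IsPfaffianBipartite.not_isMatchingMinor_univ_fin_three {n : ℕ}
    {G : Finset (Fin n × Fin n)} (hG : IsPfaffianBipartite G) :
    ¬ IsMatchingMinor (Finset.univ : Finset (Fin 3 × Fin 3)) G :=
  fun h => h.not_isPfaffianBipartite hG

end Literature.Combinatorics.SimpleGraph
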